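import Summits.BirchSwinnertonDyer.BirchSwinnertonDyer.Theorems.KatoDescentPotSupersingularWildFineSelmerCMAnchor
import Summits.BirchSwinnertonDyer.BirchSwinnertonDyer.Theorems.KatoDescentTamePotSupersingularTameFineSelmerCongruenceRoad
import Literature.NumberTheory.EllipticCurves.Kobayashi2003.FineSelmerLeSignedSelmerProofs
import Literature.NumberTheory.EllipticCurves.Kobayashi2003.SignedSelmerModuleFiniteProofs
import Literature.NumberTheory.EllipticCurves.Kobayashi2003.SignedSelmerDualExistsProofs
import Literature.NumberTheory.EllipticCurves.PollackRubin2004.SignedMainTheoremCM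
import HarnessLib

/-!
# Routes `KatoDescentPotSupersingular` (K9) / `KatoDescentTamePotSupersingular` (KT), cell `bsd-potss`:
# CM anchors at a SUPERSINGULAR prime for the congruence road to the Conj-A cruxes
# `WildFineSelmerCoatesSujatha` (item stmt-BirchSwinnertonDyer-19386) and `TameFineSelmerCoatesSujatha`
# (item 19413) — the KERNEL LINK «CM anchor `E′` (good supersingular at `p`) + ONE unit coefficient of
# its Néron-normalised signed `p`-adic `L`-function `ϖ·L^∓` ⟹ `Sel^±(E′/ℚ^cyc)[p]` finite ⟹
# `Sel₀(E′/ℚ^cyc)[p]` finite ⟹ (A) at `(E′,p)`» below Pollack–Rubin's theorem (tree fact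
# `PollackRubin2004.mainTheorem_signedCharIdeal_eq_of_cm`) and the «± ⊇ fine» bridge
# (`Kobayashi2003.fineSelmerInfty_le_signedSelmerInfty`, Literature, seat `bsd-potss-conjA-anchor` g2);
# ROUTE-FREE (a `--supports … --as helper` file; nothing booked, BSD is not proved by any of this,
# items 19386 / 19413 are NOT closed)

THE ROAD (seats k9-c4 g3/g4, conjA-anchor g0): on a row `W` of either crux (wild `3` resp. tame `p ≥ 5`,
`r_an = 0`, `W[p]` irreducible, tower not onto), Upper at `(W,p)` ⟸ (A) at `(W,p)` ⟸ [Lim–Sujatha 2018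
Prop. 3.2, fact p445851] (A) at `(W′,p)` for ONE `W′` with `W′[p] ≃ W[p]`. The census of seat
`bsd-potss-conjA-anchor` g0 (HOME/conjA-anchor/ANCHOR-CENSUS-conjA-anchor-g0.tsv, kit j257913: 484/484
(row, CM anchor) pairs certified) found, besides the 69 K9 `N_s(3)` rows with a good-ORDINARY CM anchor
(served by `…WildFineSelmerCMAnchor`, Rubin 1991 Thm. 12.3), **101 K9 `N_ns(3)` rows (57 ♯) and the KT
row `280525t1` at `p = 5` whose only certified anchor is a CM curve SUPERSINGULAR at `p`** (discriminants
`−4, −7, −19, −43, …`; e.g. `32a`, `49a`, `361a`, `1849a`; `280525t1 ↔ 49a` at `5`). For those the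
classical Selmer group is useless (`X(E′/ℚ_∞)` has positive `Λ`-rank at a supersingular prime); the
integral statement in print is Kobayashi's SIGNED main conjecture, a THEOREM for CM curves
(Pollack–Rubin 2004): `char X^±(E′/ℚ_∞) = (ϖ·L^∓)`. Hence:

* §1 `conjA_of_finite_fineSelmerInfty_pTorsion` — the unconditional kernel step «`Sel₀(K_∞)[p]` finite
  ⟹ `X₀(E/K_∞)` finitely generated over `ℤ_p`» (k9-c4's `conjA_of_finite_selmerInfty_pTorsion` with
  its first line removed: `X₀/(p,T)` finite ⟹ `X₀/p` finite ⟹ torsion, `μ = 0` ⟹ f.g./`ℤ_p`).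
* §2 `finite_signedSelmerInfty_pTorsion_of_cm_supersingular_of_unitCoeff` — for `W′/ℚ` globally minimal
  with CM, `p ≠ 2` good supersingular, the newform `f`, `ϖ` with `ϖ·Ω_{W′} = Ω⁺_f`, a Pollack pair
  `(L⁺, L⁻)` and ONE index `n` with `‖coeff_n(ϖ·L^ε')‖_p = 1` (`L^ε' = L⁻` for `ε = 1`, `L⁺` for
  `ε = −1`, Kobayashi's labelling — a `μ^ε`-CERTIFICATE): `Sel^ε(W′/ℚ_∞)[p]` is finite for every
  cyclotomic datum with a topological generator matching the cyclotomic variable. Chain, all in the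
  kernel below the ONE named fact: `X^ε = Hom(Sel^ε, ℚ/ℤ)` (`signedSelmerDualData`, f.g./`Λ` by
  `SignedSelmerDualData.moduleFinite`); Pollack–Rubin: torsion and `char X^ε = (g)`, `ι g = ϖ·ι L^ε'`;
  the certificate reads `coeff_n g ∈ ℤ_pˣ`; ⟹ `μ(X^ε) = 0` ⟹ `X^ε` f.g./`ℤ_p` ⟹ `X^ε/p` finite ⟹
  `Sel^ε[p]` finite (Pontryagin) — steps verbatim as in the Rubin/ordinary links.
  `finite_fineSelmerInfty_pTorsion_of_cm_supersingular_of_unitCoeff`: ⟹ `Sel₀[p]` finite for EVERY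
  cyclotomic datum (the bridge `Sel₀ ≤ Sel^ε` at the normalised datum, then transport along
  `ker κ₀ = ker κ`); `conjA_of_cm_supersingular_of_unitCoeff`: ⟹ (A) at `(W′,p)` (§1).
* §3 the per-row roads: `missingUpperBoundAt_wild_of_cmSupersingularAnchor` (K9 currency, `p = 3`,
  through k9-c4's `WildFineSelmerCongruence.missingUpperBoundAt_wild_of_congruentConjA`) and
  `missingUpperBoundAt_tame_of_cmSupersingularAnchor` ((t′) currency, `p ≠ 2`, through k8t-c4's
  `TameFineSelmerCongruence.missingUpperBoundAt_tame_of_congruentConjA`): Upper at the row ⟸ {Lim–Sujatha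
  p445851, Kato fine-Selmer reading p420034, Pollack–Rubin, GZK, modularity} + ONE globally minimal CM
  anchor `W′` (`ModPCongruent W′ W p`, CM, good supersingular at `p`) + its newform/period data + a
  Pollack pair + ONE unit coefficient. The (A)-at-the-anchor output is exactly currency (i) of g0's
  `WildFineSelmerCMAnchor.wildFineSelmerCoatesSujatha_of_anchorCertificates`, so no new assembly
  theorem is needed for the crux body.

Certificates of record (evidence, not inputs): kit j257913 of seat g0 — PARI `ellpadicL`-based
`[[λ⁺,λ⁻],[μ⁺,μ⁻]]`, e.g. `49a @5: [[0,0],[0,0]]`, `32a @3: [[0,0],[0,0]]`; `μ^± = 0` exhibited on 91 of the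
101 K9 rows' anchors. CONDITIONAL on the displayed named facts (audit `proof.conditional`); no definition,
no new fact, no census number is an input.

References: [PollackRubin2004] Theorem (p. 448) = Thm. 7.3, §1, §7 (10)–(11); [Kobayashi2003] Def. 1.1,
Thm. 1.2, (3.6); [Pollack2003] §6.2.2; [LimSujatha2018] §3 Prop. 3.2; [CoatesSujatha2005] §3;
[Kato2004Asterisque] Thm. 14.5 (3); [GreenbergVatsal2000] §2 Prop. (2.8); [Washington1997] §13.
-/

set_option autoImplicit false
-- sibling precedent (`KatoDescentPotSupersingularAssembly.lean`): the directory name repeats the summit name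
set_option linter.dupNamespace false

noncomputable section

open scoped Classical AddSubgroup MatrixGroups ModularForm

universe u

namespace Summit.BirchSwinnertonDyer.BirchSwinnertonDyer.Theorems.WildFineSelmerCMSupersingularAnchor

open CongruenceSubgroup WeierstrassCurve Literature.NumberTheory.EllipticCurves
  Literature.NumberTheory.EllipticCurves.ModularForms
  Literature.NumberTheory.EllipticCurves.IwasawaAlgebra
  Literature.NumberTheory.EllipticCurves.Rank1Residual
  Literature.NumberTheory.EllipticCurves.Rank1Residual.Typed
  Literature.NumberTheory.EllipticCurves.Kobayashi2003
  Summit.BirchSwinnertonDyer.Rank1Residual Summit.BirchSwinnertonDyer.Rank1Residual.Additive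
  Summit.BirchSwinnertonDyer.Rank1Residual.O6
  Summit.BirchSwinnertonDyer.BirchSwinnertonDyer.Theorems

/-! ## §1 (A) from the finiteness of `Sel₀(K_∞)[p]` (the unconditional kernel step) -/

/-- **Coates–Sujatha's (A) in the kernel from «`Sel₀(K_∞)[p]` finite».** For an elliptic curve `W/K`
over a number field, a prime `p`, a `ℤ_p`-extension `κ` with topological generator `γ`: if the `p`-torsion
classes of the FINE Selmer group `Sel₀(K_∞, E[p^∞])` form a finite set, then its Pontryagin dual `X₀` is
finitely generated over `ℤ_p` — (A) at `(W,p)` over `K_∞`, in the tree's `∃`-form. Chain: `X₀/(p,T)`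
finite (`FineSelmerDualData.finite_quotient_augIdealP_of_finite_pTorsion`) ⟹ `X₀/p` finite ⟹ (`X₀`
f.g./`Λ`) torsion with `μ(X₀) = 0` ⟹ f.g./`ℤ_p`. (k9-c4's `conjA_of_finite_selmerInfty_pTorsion` starts
one step earlier, from the CLASSICAL Selmer group; at a supersingular anchor only the fine/signed groups
are cotorsion, whence this entry point.) Unconditional kernel theorem.
[cite: CoatesSujatha2005, §3] [cite: GreenbergVatsal2000, §2 Prop. (2.8) (p. 25)] -/
theorem conjA_of_finite_fineSelmerInfty_pTorsion {K : Type u} [Field K] [NumberField K]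
    (W : WeierstrassCurve K) [W.IsElliptic] {p : ℕ} [Fact p.Prime] (κ : ZpExtension K p)
    {γ : Field.absoluteGaloisGroup K} (hγ : κ.IsTopGenerator γ)
    (h0 : Set.Finite {s : W.fineSelmerInfty κ | p • s = 0}) :
    ∃ (γ' : Field.absoluteGaloisGroup K) (D : W.FineSelmerDualData κ γ'),
      Module.Finite ℤ_[p] (RestrictScalars ℤ_[p] (IwasawaAlgebra p) D.X) := by
  let D : W.FineSelmerDualData κ γ := W.fineSelmerDualData κ hγ
  haveI hfg : Module.Finite (IwasawaAlgebra p) D.X := FineSelmerDualData.module_finite (W := W) κ hγ D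
  have hq : Finite (D.X ⧸ (augIdealP p • (⊤ : Submodule (IwasawaAlgebra p) D.X))) :=
    D.finite_quotient_augIdealP_of_finite_pTorsion h0
  have hmodN : Finite (ModN D.X p) := by
    apply Nat.finite_of_card_ne_zero
    rw [← Iwasawa.natCard_quotient_augIdealP_smul_top_eq_natCard_modN p]
    exact (Nat.card_pos (α := D.X ⧸ (augIdealP p • (⊤ : Submodule (IwasawaAlgebra p) D.X)))).ne'
  haveI := hmodN
  have hT : Module.IsTorsion (IwasawaAlgebra p) D.X := Iwasawa.isTorsion_of_finite_modN p D.X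
  have hμ : muInvariant p D.X = 0 :=
    X2.MuVanishingOfFiniteModP.muInvariant_eq_zero_of_finite_modN' p D.X hT hmodN
  exact ⟨γ, D, X2.NonPrimitiveSelmerTorsionCard.moduleFinite_int_of_muInvariant_eq_zero p D.X hT hμ⟩

/-- Transport of «`Sel₀(K_∞)[p]` finite» between `ℤ_p`-extension data with the same kernel (e.g. two
cyclotomic data: `IsCyclotomic.kerSubgroup_eq`) — the fine Selmer group only depends on `ker κ`
(Greenberg's strict Selmer group of `K̄^{ker κ}`). [folklore] -/
theorem finite_pTorsion_strictSelmerGroupOver_of_eq {K : Type u} [Field K] [NumberField K]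
    {M : Type u} [AddCommGroup M] [DistribMulAction (Field.absoluteGaloisGroup K) M]
    [TopologicalSpace M] [DiscreteTopology M] {p : ℕ} (L : GreenbergSelmer.Data K M p)
    {H₀ H : Subgroup (Field.absoluteGaloisGroup K)} [H₀.Normal] [H.Normal] (h : H₀ = H)
    (hfin : Set.Finite {s : GreenbergSelmer.strictSelmerGroupOver H₀ M p L | p • s = 0}) :
    Set.Finite {s : GreenbergSelmer.strictSelmerGroupOver H M p L | p • s = 0} := by
  subst h
  exact hfin

/-! ## §2 CM supersingular anchor + one unit coefficient ⟹ `Sel^ε[p]`, `Sel₀[p]` finite ⟹ (A) -/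

/-- **The CM `μ^±`-certificate criterion, in the kernel below Pollack–Rubin's theorem.** Let `E′/ℚ` be
given by a globally minimal `W` with complex multiplication, `p ≠ 2` a prime of good SUPERSINGULAR
reduction (`GoodSS W p`), `f` the newform of `E′`, `ϖ ∈ ℚ` with `ϖ·Ω_{E′} = Ω⁺_f`, `(L⁺, L⁻)` a Pollack
pair for `f` (non-zero solutions of Pollack's congruences — they exist by `pollack_exists_plusMinusPAdicLFunction`),
`ε` a sign and `L^ε' = L⁻` if `ε = 1`, `L⁺` if `ε = −1` (Kobayashi's labelling), and assume the
`μ^ε`-CERTIFICATE: some coefficient of `ϖ·L^ε'` is a `p`-adic unit. Then for every cyclotomic datum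
`κ` with topological generator `γ` matching the cyclotomic variable, `Sel^ε(E′/ℚ_∞)[p]` is finite (indeed
`X^ε(E′/ℚ_∞)` is finitely generated over `ℤ_p`: `char X^ε = (ϖ·L^ε')` integrally by Pollack–Rubin, so
`μ(X^ε) = 0`). [cite: PollackRubin2004, Theorem (p. 448) = Thm. 7.3] [cite: Kobayashi2003, Def. 1.1 and Thm. 1.2]
[cite: Washington1997, §13.2] -/
theorem finite_signedSelmerInfty_pTorsion_of_cm_supersingular_of_unitCoeff
    (hPR : PollackRubin2004.mainTheorem_signedCharIdeal_eq_of_cm)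
    (W : WeierstrassCurve ℚ) [W.IsElliptic] [W.IsGloballyMinimal] {p : ℕ} [Fact p.Prime]
    (hcm : W.HasCM) (hp : p ≠ 2) (hss : GoodSS W p) (ε : ℤˣ)
    [NeZero (W.conductorNorm ℤ)] (f : CuspForm (Gamma0 (W.conductorNorm ℤ)) 2) (hf : IsNewformOf W f)
    (ϖ : ℚ) (hϖ : (ϖ : ℝ) * W.realPeriodRat = plusPeriod f)
    (Lplus Lminus : IwasawaAlgebra p)
    (hL : Lplus ≠ 0 ∧ Lminus ≠ 0 ∧
      (∀ n : ℕ, Odd n →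
        IsCongrModOmega p n (mazurTateElement f p n) ((-1) ^ (n / 2 + 1) * cyclotomicOmegaPlus p n) Lplus) ∧
      (∀ n : ℕ, Even n →
        IsCongrModOmega p n (mazurTateElement f p n) ((-1) ^ (n / 2 + 1) * cyclotomicOmegaMinus p n) Lminus))
    (hunit : ∃ n : ℕ, ‖PowerSeries.coeff n (PowerSeries.C (ϖ : ℚ_[p]) *
        iwasawaToPowerSeries p (if ε = 1 then Lminus else Lplus))‖ = 1)
    {κ : ZpExtension ℚ p} {γ : Field.absoluteGaloisGroup ℚ} (hκ : κ.IsCyclotomic)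
    (hγ : κ.IsTopGenerator γ) (hγ' : IsCyclotomicVariable p γ) :
    Set.Finite {s : signedSelmerInfty W κ ε | p • s = 0} := by
  -- (1) the signed Iwasawa module, literally the character group of `Sel^ε_∞`
  set D : SignedSelmerDualData W κ γ ε := signedSelmerDualData W κ ε hγ with hDdef
  haveI hfg : Module.Finite (IwasawaAlgebra p) D.X := SignedSelmerDualData.moduleFinite hγ D
  -- (2) Pollack–Rubin: `X^ε` is `Λ`-torsion and `char X^ε = (g)` with `ι g = ϖ · ι L^ε'`
  obtain ⟨hX, g, hg, hιg⟩ := hPR W p hcm hp hss ε κ γ hκ hγ hγ' f hf ϖ hϖ Lplus Lminus hL D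
  -- (3) the certificate: the `n`-th coefficient of `g` is a `p`-adic unit
  obtain ⟨n, hn⟩ := hunit
  have hcoeff : PowerSeries.coeff n (PowerSeries.C (ϖ : ℚ_[p]) *
      iwasawaToPowerSeries p (if ε = 1 then Lminus else Lplus)) =
        ((PowerSeries.coeff n g : ℤ_[p]) : ℚ_[p]) := by
    rw [← hιg, PowerSeries.coeff_map]; rfl
  have hunit' : IsUnit (PowerSeries.coeff n g) := by
    rw [PadicInt.isUnit_iff, ← PadicInt.padic_norm_e_of_padicInt, ← hcoeff]
    exact hn
  -- (4) `μ(X^ε) = 0`, hence `X^ε` finitely generated over `ℤ_p`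
  have hμ : muInvariant p D.X = 0 :=
    (muInvariant_eq_zero_iff_exists_isUnit_coeff_of_charIdeal_eq_span D.X hX hg).mpr ⟨n, hunit'⟩
  letI : Module ℤ_[p] D.X := Module.compHom D.X (algebraMap ℤ_[p] (IwasawaAlgebra p))
  haveI hfgZp : Module.Finite ℤ_[p] D.X :=
    X2.NonPrimitiveSelmerTorsionCard.moduleFinite_int_of_muInvariant_eq_zero p D.X hX hμ
  -- (5) `X^ε/pX^ε` finite ⟹ `Sel^ε_∞[p]` finite (`X^ε = Hom(Sel^ε_∞, ℚ/ℤ)` literally)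
  have hmodN : Finite (ModN D.X p) := (ZpCorank.natCard_modN_le p D.X).1
  have hmodN' : Finite (ModN (CharacterModule (signedSelmerInfty W κ ε)) p) := hmodN
  have hcard : Nat.card (ModN (CharacterModule (signedSelmerInfty W κ ε)) p) =
      Nat.card ((signedSelmerInfty W κ ε)[(p : ℤ)]) :=
    Iwasawa.natCard_modN_characterModule_eq p (signedSelmerInfty W κ ε)
  haveI hfinT : Finite ((signedSelmerInfty W κ ε)[(p : ℤ)]) := by
    apply Nat.finite_of_card_ne_zero
    rw [← hcard]
    exact Nat.card_pos.ne'
  have hset : {s : signedSelmerInfty W κ ε | p • s = 0} =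
      (((signedSelmerInfty W κ ε)[(p : ℤ)] : AddSubgroup (signedSelmerInfty W κ ε)) :
        Set (signedSelmerInfty W κ ε)) := by
    ext s
    rw [Set.mem_setOf_eq, SetLike.mem_coe, AddSubgroup.torsionBy.nsmul_iff]
  rw [hset]
  exact Set.toFinite _

/-- **`Sel₀(E′/ℚ_∞)[p]` finite from a CM supersingular `μ^ε`-certificate, for EVERY cyclotomic datum.**
Same hypotheses; conclusion for every cyclotomic `κ`: the `p`-torsion of the fine Selmer group over the
top of `κ` is a finite set — through the «± ⊇ fine» bridge `Kobayashi2003.fineSelmerInfty_le_signedSelmerInfty`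
at the normalised datum `(κ₀, γ₀)` (`exists_isCyclotomic_isTopGenerator_isCyclotomicVariable_holds`) and
transport along `ker κ₀ = ker κ`. [cite: PollackRubin2004, Theorem (p. 448) = Thm. 7.3]
[cite: Kobayashi2003, Def. 1.1] [cite: CoatesSujatha2005, §3] -/
theorem finite_fineSelmerInfty_pTorsion_of_cm_supersingular_of_unitCoeff
    (hPR : PollackRubin2004.mainTheorem_signedCharIdeal_eq_of_cm)
    (W : WeierstrassCurve ℚ) [W.IsElliptic] [W.IsGloballyMinimal] {p : ℕ} [Fact p.Prime]
    (hcm : W.HasCM) (hp : p ≠ 2) (hss : GoodSS W p) (ε : ℤˣ)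
    [NeZero (W.conductorNorm ℤ)] (f : CuspForm (Gamma0 (W.conductorNorm ℤ)) 2) (hf : IsNewformOf W f)
    (ϖ : ℚ) (hϖ : (ϖ : ℝ) * W.realPeriodRat = plusPeriod f)
    (Lplus Lminus : IwasawaAlgebra p)
    (hL : Lplus ≠ 0 ∧ Lminus ≠ 0 ∧
      (∀ n : ℕ, Odd n →
        IsCongrModOmega p n (mazurTateElement f p n) ((-1) ^ (n / 2 + 1) * cyclotomicOmegaPlus p n) Lplus) ∧
      (∀ n : ℕ, Even n →
        IsCongrModOmega p n (mazurTateElement f p n) ((-1) ^ (n / 2 + 1) * cyclotomicOmegaMinus p n) Lminus))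
    (hunit : ∃ n : ℕ, ‖PowerSeries.coeff n (PowerSeries.C (ϖ : ℚ_[p]) *
        iwasawaToPowerSeries p (if ε = 1 then Lminus else Lplus))‖ = 1)
    (κ : ZpExtension ℚ p) (hκ : κ.IsCyclotomic) :
    Set.Finite {s : W.fineSelmerInfty κ | p • s = 0} := by
  obtain ⟨κ₀, hκ₀, γ₀, hγ₀, hγ₀'⟩ := exists_isCyclotomic_isTopGenerator_isCyclotomicVariable_holds p
  have h0 : Set.Finite {s : W.fineSelmerInfty κ₀ | p • s = 0} :=
    Kobayashi2003.finite_fineSelmerInfty_pTorsion_of_finite_signedSelmerInfty_pTorsion W κ₀ ε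
      (finite_signedSelmerInfty_pTorsion_of_cm_supersingular_of_unitCoeff hPR W hcm hp hss ε f hf ϖ hϖ
        Lplus Lminus hL hunit hκ₀ hγ₀ hγ₀')
  exact finite_pTorsion_strictSelmerGroupOver_of_eq
    (GreenbergSelmer.fineData (W.geomPrimaryTorsion p) p) (hκ₀.kerSubgroup_eq hκ) h0

/-- **(A) at a CM SUPERSINGULAR anchor from its `μ^ε`-certificate.** Same hypotheses; conclusion:
Coates–Sujatha's (A) at `(E′,p)` — `X₀(E′/ℚ_∞)` finitely generated over `ℤ_p` — for every cyclotomic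
datum (§1 at the fine group). This is currency (i) «(A) at the anchor outright» of
`WildFineSelmerCMAnchor.wildFineSelmerCoatesSujatha_of_anchorCertificates`.
[cite: PollackRubin2004, Theorem (p. 448) = Thm. 7.3] [cite: CoatesSujatha2005, §3] -/
theorem conjA_of_cm_supersingular_of_unitCoeff
    (hPR : PollackRubin2004.mainTheorem_signedCharIdeal_eq_of_cm)
    (W : WeierstrassCurve ℚ) [W.IsElliptic] [W.IsGloballyMinimal] {p : ℕ} [Fact p.Prime]
    (hcm : W.HasCM) (hp : p ≠ 2) (hss : GoodSS W p) (ε : ℤˣ)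
    [NeZero (W.conductorNorm ℤ)] (f : CuspForm (Gamma0 (W.conductorNorm ℤ)) 2) (hf : IsNewformOf W f)
    (ϖ : ℚ) (hϖ : (ϖ : ℝ) * W.realPeriodRat = plusPeriod f)
    (Lplus Lminus : IwasawaAlgebra p)
    (hL : Lplus ≠ 0 ∧ Lminus ≠ 0 ∧
      (∀ n : ℕ, Odd n →
        IsCongrModOmega p n (mazurTateElement f p n) ((-1) ^ (n / 2 + 1) * cyclotomicOmegaPlus p n) Lplus) ∧
      (∀ n : ℕ, Even n →
        IsCongrModOmega p n (mazurTateElement f p n) ((-1) ^ (n / 2 + 1) * cyclotomicOmegaMinus p n) Lminus))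
    (hunit : ∃ n : ℕ, ‖PowerSeries.coeff n (PowerSeries.C (ϖ : ℚ_[p]) *
        iwasawaToPowerSeries p (if ε = 1 then Lminus else Lplus))‖ = 1) :
    ∀ (κ : ZpExtension ℚ p), κ.IsCyclotomic →
      ∃ (γ : Field.absoluteGaloisGroup ℚ) (D : W.FineSelmerDualData κ γ),
        Module.Finite ℤ_[p] (RestrictScalars ℤ_[p] (IwasawaAlgebra p) D.X) := by
  intro κ hκ
  obtain ⟨γ, hγ⟩ : ∃ γ : Field.absoluteGaloisGroup ℚ, κ.IsTopGenerator γ :=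
    κ.surjective (Multiplicative.ofAdd 1)
  exact conjA_of_finite_fineSelmerInfty_pTorsion W κ hγ
    (finite_fineSelmerInfty_pTorsion_of_cm_supersingular_of_unitCoeff hPR W hcm hp hss ε f hf ϖ hϖ
      Lplus Lminus hL hunit κ hκ)

/-! ## §3 The per-row roads: Upper at a row from ONE congruent CM supersingular anchor + a certificate -/

/-- **The congruence road with a CM SUPERSINGULAR ANCHOR, row form (K9 currency).** Let `W/ℚ` be a row
of the Conj-A crux of route K9: globally minimal, `r_an = 0`, `ClassO6 W 3` (additive, potentially good,
wild at `3`), `W[3]` irreducible. Suppose ONE globally minimal `W′/ℚ` is given with `W′[3] ≃ W[3]`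
(`O6.ModPCongruent W′ W 3`), complex multiplication, GOOD SUPERSINGULAR at `3`, with its newform `f`,
period ratio `ϖ`, a Pollack pair `(L⁺, L⁻)` at `3`, a sign `ε` and ONE unit coefficient of `ϖ·L^ε'`.
Then `ord₃ #Ш(E) ≤ ord₃ #Ш(E)_an` (`MissingUpperBoundAt W 3`) — below the named facts Lim–Sujatha 2018
Prop. 3.2 (`hLS`, p445851), Kato's fine-Selmer reading of 14.5 (3) (`hKatoA`, p420034), Pollack–Rubin
(`hPR`), GZK (`hGZK`) and modularity (`hmod`). Chain: certificate ⟹ (A) at `(E′,3)` (§2) ⟹ (A) at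
`(E,3)` ⟹ Upper (k9-c4 g3's `WildFineSelmerCongruence.missingUpperBoundAt_wild_of_congruentConjA`).
Census of record: 101 `N_ns(3)` rows (57 ♯) meet such an anchor (e.g. `32a`, `49a`, `361a`, `1849a`
and twists), `μ^± = 0` exhibited by PARI on 91 of them (seat g0, kit j257913).
[cite: LimSujatha2018, §3 Prop. 3.2] [cite: PollackRubin2004, Theorem (p. 448) = Thm. 7.3]
[cite: Kato2004Asterisque, Thm. 14.5 (3)] -/
theorem missingUpperBoundAt_wild_of_cmSupersingularAnchor
    (hLS : LimSujatha2018.prop32_fineSelmerDual_moduleFinite_iff_of_torsionIso)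
    (hKatoA :
      Kato2004.rankZero_padicValNat_sha_add_padicValNat_tamagawa_le_of_additive_potGood_of_irreducible_of_fineSelmerDual_fg)
    (hPR : PollackRubin2004.mainTheorem_signedCharIdeal_eq_of_cm)
    (hGZK : rank_eq_analyticRank_of_analyticRank_le_one) (hmod : hasEntireLFunction_rat)
    (W : WeierstrassCurve ℚ) [W.IsElliptic] [W.IsGloballyMinimal] [Fact (3 : ℕ).Prime]
    (hr : W.analyticRank = 0) (hO : ClassO6 W 3) (hirr : W.HasIrreducibleModPGaloisRep 3)
    (W' : WeierstrassCurve ℚ) [W'.IsElliptic] [W'.IsGloballyMinimal] (hcong : ModPCongruent W' W 3)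
    (hcm' : W'.HasCM) (hss' : GoodSS W' 3) (ε : ℤˣ)
    [NeZero (W'.conductorNorm ℤ)] (f : CuspForm (Gamma0 (W'.conductorNorm ℤ)) 2) (hf : IsNewformOf W' f)
    (ϖ : ℚ) (hϖ : (ϖ : ℝ) * W'.realPeriodRat = plusPeriod f)
    (Lplus Lminus : IwasawaAlgebra 3)
    (hL : Lplus ≠ 0 ∧ Lminus ≠ 0 ∧
      (∀ n : ℕ, Odd n →
        IsCongrModOmega 3 n (mazurTateElement f 3 n) ((-1) ^ (n / 2 + 1) * cyclotomicOmegaPlus 3 n) Lplus) ∧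
      (∀ n : ℕ, Even n →
        IsCongrModOmega 3 n (mazurTateElement f 3 n) ((-1) ^ (n / 2 + 1) * cyclotomicOmegaMinus 3 n) Lminus))
    (hunit : ∃ n : ℕ, ‖PowerSeries.coeff n (PowerSeries.C (ϖ : ℚ_[3]) *
        iwasawaToPowerSeries 3 (if ε = 1 then Lminus else Lplus))‖ = 1) :
    MissingUpperBoundAt W 3 := by
  -- (A) at `(W′, 3)` from the certificate, then (A) at `(W, 3)` by Lim–Sujatha
  have hA : ∀ (κ : ZpExtension ℚ 3), κ.IsCyclotomic →
      ∃ (γ : Field.absoluteGaloisGroup ℚ) (D : W.FineSelmerDualData κ γ),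
        Module.Finite ℤ_[3] (RestrictScalars ℤ_[3] (IwasawaAlgebra 3) D.X) :=
    WildFineSelmerCongruenceFact.conjA_of_modPCongruent hLS (by norm_num) hcong
      (conjA_of_cm_supersingular_of_unitCoeff hPR W' hcm' (by decide) hss' ε f hf ϖ hϖ Lplus Lminus hL
        hunit)
  -- Kato's A161″ conclusion at `W` (p420034 at the Conj-A binding) in Miller's currency, as in k9-c4's road
  have hL1 : W.entireLFunction 1 ≠ 0 := (W.analyticRank_eq_zero_iff_holds (hmod W)).mp hr
  obtain ⟨-, hfin⟩ := hGZK W (by rw [hr]; exact zero_le_one)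
  obtain ⟨q₀, hq₀, hle⟩ := WildFineSelmerCongruence.x4UpperOfFineMuZero_conjA hKatoA W 3 hO.1 hO.2.1.1
    hO.2.1.2 hO.padicValRat_j_nonneg hirr (fun κ hκ ↦ hA κ hκ) hL1 hfin
  have ht0 : padicValNat 3 W.torsionOrder = 0 := padicValNat_torsionOrder_eq_zero_of_irreducible W 3 hirr
  obtain ⟨q, hq, hle'⟩ := exists_shaAn_le_add_torsion_of_katoCurrency hGZK hmod W 3 hr hfin hq₀
    (by rw [ht0, Nat.cast_zero, mul_zero, add_zero]; exact hle)
  refine ⟨q, hq, ?_⟩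
  rw [ht0, Nat.cast_zero, add_zero] at hle'
  exact hle'

/-- **The congruence road with a CM SUPERSINGULAR ANCHOR, row form ((t′) currency of route KT).** Let
`W/ℚ` be a row of the Conj-A crux of route KT: globally minimal, `r_an = 0`, `p ≠ 2` additive of sub-type
(t′) (`Addv`, `SubTprime`), `W[p]` irreducible. ONE globally minimal CM anchor `W′` with `W′[p] ≃ W[p]`,
good supersingular at `p`, its newform/period data, a Pollack pair, a sign and ONE unit coefficient of
`ϖ·L^ε'` give `ord_p #Ш(E) ≤ ord_p #Ш(E)_an` — below `hLS`, `hKatoA`, `hPR`, `hGZK`, `hmod`, through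
k8t-c4's `TameFineSelmerCongruence.missingUpperBoundAt_tame_of_congruentConjA`. Census of record: the row
`280525t1` at `p = 5` (e = 6, image `N_ns`) with the anchor `49a` (CM by `−7`, `5` inert;
`[[λ⁺,λ⁻],[μ⁺,μ⁻]] = [[0,0],[0,0]]`, kit j257688/j257913) — the single anchored row of the stub
`stub_fineA_tame_five_le`. [cite: LimSujatha2018, §3 Prop. 3.2]
[cite: PollackRubin2004, Theorem (p. 448) = Thm. 7.3] [cite: Kato2004Asterisque, Thm. 14.5 (3)] -/
theorem missingUpperBoundAt_tame_of_cmSupersingularAnchor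
    (hLS : LimSujatha2018.prop32_fineSelmerDual_moduleFinite_iff_of_torsionIso)
    (hKatoA :
      Kato2004.rankZero_padicValNat_sha_add_padicValNat_tamagawa_le_of_additive_potGood_of_irreducible_of_fineSelmerDual_fg)
    (hPR : PollackRubin2004.mainTheorem_signedCharIdeal_eq_of_cm)
    (hGZK : rank_eq_analyticRank_of_analyticRank_le_one) (hmod : hasEntireLFunction_rat)
    (W : WeierstrassCurve ℚ) [W.IsElliptic] [W.IsGloballyMinimal] (p : ℕ) [Fact p.Prime]
    (hr : W.analyticRank = 0) (hp : p ≠ 2) (hadd : Addv W p) (hT : SubTprime W p)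
    (hirr : W.HasIrreducibleModPGaloisRep p)
    (W' : WeierstrassCurve ℚ) [W'.IsElliptic] [W'.IsGloballyMinimal] (hcong : ModPCongruent W' W p)
    (hcm' : W'.HasCM) (hss' : GoodSS W' p) (ε : ℤˣ)
    [NeZero (W'.conductorNorm ℤ)] (f : CuspForm (Gamma0 (W'.conductorNorm ℤ)) 2) (hf : IsNewformOf W' f)
    (ϖ : ℚ) (hϖ : (ϖ : ℝ) * W'.realPeriodRat = plusPeriod f)
    (Lplus Lminus : IwasawaAlgebra p)
    (hL : Lplus ≠ 0 ∧ Lminus ≠ 0 ∧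
      (∀ n : ℕ, Odd n →
        IsCongrModOmega p n (mazurTateElement f p n) ((-1) ^ (n / 2 + 1) * cyclotomicOmegaPlus p n) Lplus) ∧
      (∀ n : ℕ, Even n →
        IsCongrModOmega p n (mazurTateElement f p n) ((-1) ^ (n / 2 + 1) * cyclotomicOmegaMinus p n) Lminus))
    (hunit : ∃ n : ℕ, ‖PowerSeries.coeff n (PowerSeries.C (ϖ : ℚ_[p]) *
        iwasawaToPowerSeries p (if ε = 1 then Lminus else Lplus))‖ = 1) :
    MissingUpperBoundAt W p :=
  TameFineSelmerCongruence.missingUpperBoundAt_tame_of_congruentConjA hLS hKatoA hGZK hmod W p hr hp hadd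
    hT hirr
    ⟨W', ‹W'.IsElliptic›, hcong, conjA_of_cm_supersingular_of_unitCoeff hPR W' hcm' hp hss' ε f hf ϖ hϖ
      Lplus Lminus hL hunit⟩

end Summit.BirchSwinnertonDyer.BirchSwinnertonDyer.Theorems.WildFineSelmerCMSupersingularAnchor

end
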